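import Summits.KontsevichZagierPeriods.KontsevichZagierPeriods.Theorems.OctahedralSymmetryOctahedralSpanAllWeightsDefs
import Mathlib.LinearAlgebra.Finsupp.LSum
import Mathlib.LinearAlgebra.Span.Basic

/-!
# Crux `OctahedralSpanAllWeights` (stmt-KontsevichZagierPeriods-9659), line `Sketch`: the REAL form of the span bound

The informal crux is stated in the free module on the REAL symbols `Re I(W)`, `Im I(W)` with six families, the
sixth being conjugation `Re I(W̄) = Re I(W)`, `Im I(W̄) = −Im I(W)`; the typed crux `OctaSpan.SpanBound` (Defs
file) is the complex word form. This file types the real form and proves that the complex form implies it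
with the SAME bound `2^w`:

* `RWordQ`, `reSym W`, `imSym W` (the real symbols), `reLin`, `imLin` (real/imaginary part of a formal
  combination with rational coefficients: `[U] ↦ Re U`, `[U] ↦ Im U`), `conjRel` (the conjugation family),
  `realRel = rel.map reLin ⊔ rel.map imLin ⊔ conjRel` (every family has rational coefficients, so the real
  and imaginary parts of a relation `ρ` are `reLin ρ`, `imLin ρ`; lifts and seeds are complex relations
  first), `RealSpanBound w` (at most `2^w` real SYMBOLS span the real symbols of the convergent words of
  weight `w` modulo `realRel`).
* `realSpanBound_of_twoLetterNormalForm : TwoLetterNormalForm w → RealSpanBound w` — the spanning symbols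
  are `Re V`, `Im V` for the `2^{w-1}` two-letter words `V` beginning with the pole `i` (one word of each
  conjugate pair; conjugation swaps the poles `±i`).
The converse (real ⟹ complex) holds too — `realRel` and `rel` have isomorphic quotients via
`Θ(re W) = ([W]+[W̄])/2`, `Θ(im W) = ([W̄]−[W])/2`, `Λ[W] = re W − im W`, using that `rel` is conjugation-stable —
and is not needed by the route. Sources: J. Zhao, Doc. Math. 15 (2010) §1–§2 [Zhao2010]; the route's item text.
-/

noncomputable section

namespace Summit.KontsevichZagierPeriods.OctahedralSymmetry.OctaSpan

open Literature.NumberTheory.Transcendental Literature.NumberTheory.Transcendental.LevelFour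

/-! ## The real module -/

/-- The free `ℚ`-module on the real symbols `(true, W) = Re I(W)`, `(false, W) = Im I(W)`. [folklore] -/
abbrev RWordQ : Type := (Bool × List (Fin 5)) →₀ ℚ

/-- The real symbol `Re I(W)`. [folklore] -/
def reSym (W : List (Fin 5)) : RWordQ := Finsupp.single (true, W) 1

/-- The real symbol `Im I(W)`. [folklore] -/
def imSym (W : List (Fin 5)) : RWordQ := Finsupp.single (false, W) 1

/-- Real part of a formal combination with rational coefficients: `[U] ↦ Re U`, linearly. [folklore] -/
def reLin : WordQ →ₗ[ℚ] RWordQ := Finsupp.lmapDomain ℚ ℚ fun W => (true, W)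

/-- Imaginary part of a formal combination with rational coefficients: `[U] ↦ Im U`, linearly. [folklore] -/
def imLin : WordQ →ₗ[ℚ] RWordQ := Finsupp.lmapDomain ℚ ℚ fun W => (false, W)

/-- `reLin [W] = Re W`. [folklore] -/
@[simp] theorem reLin_sym (W : List (Fin 5)) : reLin (sym W) = reSym W := by
  simp [reLin, sym, reSym, Finsupp.lmapDomain_apply, Finsupp.mapDomain_single]

/-- `imLin [W] = Im W`. [folklore] -/
@[simp] theorem imLin_sym (W : List (Fin 5)) : imLin (sym W) = imSym W := by
  simp [imLin, sym, imSym, Finsupp.lmapDomain_apply, Finsupp.mapDomain_single]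

/-- **The conjugation family** `Re I(W̄) − Re I(W)`, `Im I(W̄) + Im I(W)` (`W̄ = conjWord W`). [cite: Zhao2010, §1] -/
def conjRel : Submodule ℚ RWordQ :=
  Submodule.span ℚ {x | ∃ W : List (Fin 5), x = reSym (conjWord W) - reSym W ∨ x = imSym (conjWord W) + imSym W}

/-- **The real relation module**: real and imaginary parts of the complex families (which have rational
coefficients) and the conjugation family. [cite: Zhao2010, §2] -/
def realRel : Submodule ℚ RWordQ := rel.map reLin ⊔ rel.map imLin ⊔ conjRel

/-- **`RealSpanBound w`** — the real form of "corank `≤ 2^w` at weight `w`": at most `2^w` real symbols span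
the real symbols `Re I(W)`, `Im I(W)` of the convergent words of weight `w` modulo `realRel`. -/
def RealSpanBound (w : ℕ) : Prop :=
  ∃ S : Finset (Bool × List (Fin 5)), S.card ≤ 2 ^ w ∧
    ∀ W : List (Fin 5), W.length = w → IsConvergent W →
      reSym W ∈ realRel ⊔ Submodule.span ℚ ((fun p => Finsupp.single p (1 : ℚ)) '' ↑S) ∧
      imSym W ∈ realRel ⊔ Submodule.span ℚ ((fun p => Finsupp.single p (1 : ℚ)) '' ↑S)

/-! ## Conjugation of two-letter words -/

/-- `conjLetter` is an involution. [folklore] -/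
theorem conjLetter_conjLetter (a : Fin 5) : conjLetter (conjLetter a) = a := by
  fin_cases a <;> rfl

/-- `conjWord` is an involution. [folklore] -/
theorem conjWord_conjWord (W : List (Fin 5)) : conjWord (conjWord W) = W := by
  simp [conjWord, List.map_map, Function.comp_def, conjLetter_conjLetter]

/-- Conjugation preserves two-letter words (it swaps the poles `±i`). [folklore] -/
theorem conjWord_mem_twoWords {w : ℕ} {V : List (Fin 5)} (hV : V ∈ twoWords w) : conjWord V ∈ twoWords w := by
  obtain ⟨hlen, h13⟩ := (mem_twoWords_iff _ _).1 hV
  refine (mem_twoWords_iff _ _).2 ⟨by simp [conjWord, hlen], fun a ha => ?_⟩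
  obtain ⟨b, hb, rfl⟩ := List.mem_map.1 ha
  rcases h13 b hb with rfl | rfl
  · exact Or.inr rfl
  · exact Or.inl rfl

/-- The two-letter words of length `w` beginning with the pole `i` (letter `1`): one word of each
conjugate pair. [folklore] -/
def twoWordsHalf (w : ℕ) : Finset (List (Fin 5)) := (twoWords w).filter fun V => V.head? = some 1

/-- `#twoWordsHalf (m+1) ≤ 2^m`. [folklore] -/
theorem card_twoWordsHalf_le (m : ℕ) : (twoWordsHalf (m + 1)).card ≤ 2 ^ m := by
  have hsub : twoWordsHalf (m + 1) ⊆ (twoWords m).image (List.cons 1) := by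
    intro V hV
    rw [twoWordsHalf, Finset.mem_filter] at hV
    obtain ⟨hV, hhead⟩ := hV
    obtain ⟨hlen, h13⟩ := (mem_twoWords_iff _ _).1 hV
    cases V with
    | nil => simp at hlen
    | cons a V =>
      have ha : a = 1 := by simpa using hhead
      subst ha
      refine Finset.mem_image.2 ⟨V, (mem_twoWords_iff _ _).2 ⟨by simpa using hlen, fun b hb => h13 b (by simp [hb])⟩, rfl⟩
  calc (twoWordsHalf (m + 1)).card ≤ ((twoWords m).image (List.cons 1)).card := Finset.card_le_card hsub
    _ ≤ (twoWords m).card := Finset.card_image_le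
    _ ≤ 2 ^ m := card_twoWords_le m

/-- A two-letter word of positive length begins with `1` or its conjugate does. [folklore] -/
theorem mem_twoWordsHalf_or {m : ℕ} {V : List (Fin 5)} (hV : V ∈ twoWords (m + 1)) :
    V ∈ twoWordsHalf (m + 1) ∨ conjWord V ∈ twoWordsHalf (m + 1) := by
  obtain ⟨hlen, h13⟩ := (mem_twoWords_iff _ _).1 hV
  cases V with
  | nil => simp at hlen
  | cons a V =>
    rcases h13 a (by simp) with rfl | rfl
    · exact Or.inl (Finset.mem_filter.2 ⟨hV, rfl⟩)
    · exact Or.inr (Finset.mem_filter.2 ⟨conjWord_mem_twoWords hV, rfl⟩)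

/-! ## The complex normal form implies the real span bound -/

/-- The real spanning set: `Re V`, `Im V` over the two-letter words `V` beginning with the pole `i`. [folklore] -/
def realTwoSyms (w : ℕ) : Finset (Bool × List (Fin 5)) :=
  (twoWordsHalf w).image (fun V => (true, V)) ∪ (twoWordsHalf w).image (fun V => (false, V))

/-- `#realTwoSyms (m+1) ≤ 2^(m+1)`. [folklore] -/
theorem card_realTwoSyms_le (m : ℕ) : (realTwoSyms (m + 1)).card ≤ 2 ^ (m + 1) := by
  calc (realTwoSyms (m + 1)).card
      ≤ ((twoWordsHalf (m + 1)).image (fun V => (true, V))).card +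
          ((twoWordsHalf (m + 1)).image (fun V => (false, V))).card := Finset.card_union_le _ _
    _ ≤ (twoWordsHalf (m + 1)).card + (twoWordsHalf (m + 1)).card :=
        add_le_add Finset.card_image_le Finset.card_image_le
    _ ≤ 2 ^ m + 2 ^ m := add_le_add (card_twoWordsHalf_le m) (card_twoWordsHalf_le m)
    _ = 2 ^ (m + 1) := by ring

/-- The target span of the real symbols of `realTwoSyms w`. [folklore] -/
abbrev realTwoSpan (w : ℕ) : Submodule ℚ RWordQ :=
  Submodule.span ℚ ((fun p => Finsupp.single p (1 : ℚ)) '' ↑(realTwoSyms w))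

/-- `Re V`, `Im V` lie in `conjRel ⊔ realTwoSpan (m+1)` for every two-letter word `V` of length `m+1`
(directly if `V` begins with `1`, via the conjugation relations if `V̄` does). [folklore] -/
theorem re_im_mem_of_mem_twoWords {m : ℕ} {V : List (Fin 5)} (hV : V ∈ twoWords (m + 1)) :
    reSym V ∈ conjRel ⊔ realTwoSpan (m + 1) ∧ imSym V ∈ conjRel ⊔ realTwoSpan (m + 1) := by
  have hre : ∀ U ∈ twoWordsHalf (m + 1), reSym U ∈ realTwoSpan (m + 1) := fun U hU =>
    Submodule.subset_span ⟨(true, U), Finset.mem_union_left _ (Finset.mem_image.2 ⟨U, hU, rfl⟩), rfl⟩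
  have him : ∀ U ∈ twoWordsHalf (m + 1), imSym U ∈ realTwoSpan (m + 1) := fun U hU =>
    Submodule.subset_span ⟨(false, U), Finset.mem_union_right _ (Finset.mem_image.2 ⟨U, hU, rfl⟩), rfl⟩
  rcases mem_twoWordsHalf_or hV with h | h
  · exact ⟨Submodule.mem_sup_right (hre V h), Submodule.mem_sup_right (him V h)⟩
  · -- `V̄` begins with `1`: `Re V = Re V̄ − (Re V̄ − Re V)`, `Im V = (Im V̄ + Im V) − Im V̄`
    have hc1 : reSym (conjWord V) - reSym V ∈ conjRel := Submodule.subset_span ⟨V, Or.inl rfl⟩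
    have hc2 : imSym (conjWord V) + imSym V ∈ conjRel := Submodule.subset_span ⟨V, Or.inr rfl⟩
    constructor
    · have : reSym V = reSym (conjWord V) - (reSym (conjWord V) - reSym V) := by abel
      rw [this]
      exact Submodule.sub_mem _ (Submodule.mem_sup_right (hre _ h)) (Submodule.mem_sup_left hc1)
    · have : imSym V = (imSym (conjWord V) + imSym V) - imSym (conjWord V) := by abel
      rw [this]
      exact Submodule.sub_mem _ (Submodule.mem_sup_left hc2) (Submodule.mem_sup_right (him _ h))

/-- The image of `twoSpan (m+1)` under `reLin`, `imLin` lies in `conjRel ⊔ realTwoSpan (m+1)`. [folklore] -/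
theorem map_twoSpan_le (m : ℕ) :
    (twoSpan (m + 1)).map reLin ≤ conjRel ⊔ realTwoSpan (m + 1) ∧
      (twoSpan (m + 1)).map imLin ≤ conjRel ⊔ realTwoSpan (m + 1) := by
  constructor <;> rw [twoSpan, Submodule.map_span_le] <;> rintro _ ⟨V, hV, rfl⟩
  · rw [reLin_sym]; exact (re_im_mem_of_mem_twoWords (Finset.mem_coe.1 hV)).1
  · rw [imLin_sym]; exact (re_im_mem_of_mem_twoWords (Finset.mem_coe.1 hV)).2

/-- **The complex normal form implies the real span bound** (same bound `2^w`): apply the real and the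
imaginary part to `[W] = ρ + ∑ a_V [V]` and replace `Re V`, `Im V` by `Re V̄`, `−Im V̄` whenever `V` begins
with the pole `−i`. [folklore] -/
theorem realSpanBound_of_twoLetterNormalForm {w : ℕ} (h : TwoLetterNormalForm w) : RealSpanBound w := by
  cases w with
  | zero =>
    -- the empty word: `Re []` is a symbol, `Im [] = (Im [] + Im [])/2 ∈ conjRel`
    refine ⟨{(true, [])}, by simp, fun W hlen _ => ?_⟩
    have hW : W = [] := List.eq_nil_of_length_eq_zero hlen
    subst hW
    constructor
    · exact Submodule.mem_sup_right (Submodule.subset_span ⟨(true, []), by simp, rfl⟩)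
    · have hc : imSym (conjWord []) + imSym [] ∈ conjRel := Submodule.subset_span ⟨[], Or.inr rfl⟩
      have heq : imSym ([] : List (Fin 5)) = (2 : ℚ)⁻¹ • (imSym (conjWord []) + imSym []) := by
        rw [show conjWord ([] : List (Fin 5)) = [] from rfl, ← two_smul ℚ, smul_smul]; norm_num
      rw [heq]
      exact Submodule.mem_sup_left (Submodule.mem_sup_right (Submodule.smul_mem _ _ hc))
  | succ m =>
    refine ⟨realTwoSyms (m + 1), card_realTwoSyms_le m, fun W hlen hW => ?_⟩
    obtain ⟨ρ, hρ, l, hl, hsum⟩ := Submodule.mem_sup.1 (h W hlen hW)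
    have hle : conjRel ⊔ realTwoSpan (m + 1) ≤ realRel ⊔ realTwoSpan (m + 1) :=
      sup_le_sup_right le_sup_right _
    constructor
    · have : reSym W = reLin ρ + reLin l := by rw [← reLin_sym, ← hsum, map_add]
      rw [this]
      refine Submodule.add_mem _ (Submodule.mem_sup_left ?_) (hle ((map_twoSpan_le m).1 ⟨l, hl, rfl⟩))
      exact Submodule.mem_sup_left (Submodule.mem_sup_left ⟨ρ, hρ, rfl⟩)
    · have : imSym W = imLin ρ + imLin l := by rw [← imLin_sym, ← hsum, map_add]
      rw [this]
      refine Submodule.add_mem _ (Submodule.mem_sup_left ?_) (hle ((map_twoSpan_le m).2 ⟨l, hl, rfl⟩))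
      exact Submodule.mem_sup_left (Submodule.mem_sup_right ⟨ρ, hρ, rfl⟩)

end Summit.KontsevichZagierPeriods.OctahedralSymmetry.OctaSpan

end
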